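import Summits.Ventures.PercRepro.Night2SeriesClassesThreeOneCellsD

/-!
# PercRepro — the clause dichotomy of the `(3, 1)` cell through the series classes (night-2, gen 23)

`NoMeetingFat` (distinct fat missed sets are pairwise disjoint), `TriangleFat` (three pairwise distinct fat missed
sets lie in three points).  With the series-class cells of `(3, 1)`: two meeting fat pairs close `|G| = 11, 16, 17`
(the triangle, `localShadowHall_three_one_of_meeting`), two disjoint ones `|G| = 16, 17`
(`…_of_two_disjoint`), three pairs not forming a triangle (`…_of_three_not_triangle`) and four or more closures close
every size.  **`localShadowHall_three_one_of_not_clauses`**: outside the clauses «at most three fat thin closures»,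
«`|G| = 11` → at most two, pairwise disjoint», «`12 ≤ |G| ≤ 15` → three closures form a triangle», «`|G| ≥ 16` → at
most one» the cell closes (given the closers available at its size); the residue theorem is
`Night2SeriesClassesThreeOneCellsF`.
-/

namespace PercRepro.Shadow

open Finset PerFlat ThmH

variable {α : Type*} [DecidableEq α] {M : Matroid α} [M.Finite]

open scoped Classical in
/-- **Two fat thin members with different, meeting missed pairs** give the triangle (given the triangle closer). -/
theorem localShadowHall_three_one_of_meeting {G : Finset α} (hG : G ∈ flatsQ M (5 + 1))
    (hd : (gr M \ G).card = 3)
    (c3 : ∀ {p x y : α}, p ≠ x → p ≠ y → x ≠ y → (∀ a ∈ ({p, x, y} : Finset α), a ∉ coloops M G) →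
      M.eRk ((G \ {p, x} : Finset α) : Set α) ≤ ((5 : ℕ) : ℕ∞) →
      M.eRk ((G \ {p, y} : Finset α) : Set α) ≤ ((5 : ℕ) : ℕ∞) →
      M.eRk ((G \ {x, y} : Finset α) : Set α) ≤ ((5 : ℕ) : ℕ∞) → LocalShadowHall M 5 G)
    {B₀ B₁ : Finset α} (hB₀ : B₀ ∈ thinMembers M 5 G) (hB₁ : B₁ ∈ thinMembers M 5 G)
    (hf₀ : (G \ clF M B₀).card ≤ 2) (hf₁ : (G \ clF M B₁).card ≤ 2) (h01 : G \ clF M B₀ ≠ G \ clF M B₁)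
    {p : α} (hp : p ∈ (G \ clF M B₀) ∩ (G \ clF M B₁)) :
    LocalShadowHall M 5 G := by
  have hd' : (gr M \ G).card ≤ 5 := by omega
  have hc : ∀ {B : Finset α}, B ∈ thinMembers M 5 G → (G \ clF M B).card ≤ 2 → (G \ clF M B).card = 2 :=
    fun hB hle => le_antisymm hle
      (two_le_card_sdiff_of_not_lay0 hG hd' (mem_thinMembers.1 hB).1 (mem_thinMembers.1 hB).2)
  obtain ⟨x, y, hP₀, hP₁, hpx, hpy, hxy⟩ := pair_shape_of_mem_inter (hc hB₀ hf₀) (hc hB₁ hf₁) h01 hp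
  have hpG : p ∈ G := by
    have : p ∈ G \ clF M B₀ := by rw [hP₀]; simp
    exact (Finset.mem_sdiff.1 this).1
  have hxG : x ∈ G := by
    have : x ∈ G \ clF M B₀ := by rw [hP₀]; simp
    exact (Finset.mem_sdiff.1 this).1
  have hyG : y ∈ G := by
    have : y ∈ G \ clF M B₁ := by rw [hP₁]; simp
    exact (Finset.mem_sdiff.1 this).1
  have hpK : p ∉ coloops M G := notMem_coloops_of_mem_sdiff_clF hG hd' hB₀ (by rw [hP₀]; simp)
  have hxK : x ∉ coloops M G := notMem_coloops_of_mem_sdiff_clF hG hd' hB₀ (by rw [hP₀]; simp)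
  have hyK : y ∉ coloops M G := notMem_coloops_of_mem_sdiff_clF hG hd' hB₁ (by rw [hP₁]; simp)
  have hH₀ : M.eRk ((G \ {p, x} : Finset α) : Set α) ≤ ((5 : ℕ) : ℕ∞) := by
    have := eRk_clF_le_of_mem_thinMembers hB₀
    rwa [clF_eq_sdiff_sdiff_of_thin hB₀, hP₀] at this
  have hH₁ : M.eRk ((G \ {p, y} : Finset α) : Set α) ≤ ((5 : ℕ) : ℕ∞) := by
    have := eRk_clF_le_of_mem_thinMembers hB₁
    rwa [clF_eq_sdiff_sdiff_of_thin hB₁, hP₁] at this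
  have hH₂ : M.eRk ((G \ {x, y} : Finset α) : Set α) ≤ ((5 : ℕ) : ℕ∞) :=
    eRk_sdiff_pair_le_of_series' hG hH₀ hH₁
      (Finset.sdiff_sdiff_eq_self (Finset.insert_subset hpG (Finset.singleton_subset_iff.2 hxG)))
      (Finset.sdiff_sdiff_eq_self (Finset.insert_subset hpG (Finset.singleton_subset_iff.2 hyG))) hpx hpy hxy hpK
  refine c3 hpx hpy hxy ?_ hH₀ hH₁ hH₂
  intro a ha
  simp only [Finset.mem_insert, Finset.mem_singleton] at ha
  rcases ha with rfl | rfl | rfl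
  · exact hpK
  · exact hxK
  · exact hyK

open scoped Classical in
/-- **Two fat thin members with disjoint missed pairs** (given the two-pairs closer). -/
theorem localShadowHall_three_one_of_two_disjoint {G : Finset α} (hG : G ∈ flatsQ M (5 + 1))
    (hd : (gr M \ G).card = 3)
    (c22 : ∀ {p x u v : α}, p ≠ x → u ≠ v → Disjoint ({p, x} : Finset α) {u, v} →
      (∀ a ∈ ({p, x, u, v} : Finset α), a ∉ coloops M G) →
      M.eRk ((G \ {p, x} : Finset α) : Set α) ≤ ((5 : ℕ) : ℕ∞) →
      M.eRk ((G \ {u, v} : Finset α) : Set α) ≤ ((5 : ℕ) : ℕ∞) → LocalShadowHall M 5 G)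
    {B₀ B₁ : Finset α} (hB₀ : B₀ ∈ thinMembers M 5 G) (hB₁ : B₁ ∈ thinMembers M 5 G)
    (hf₀ : (G \ clF M B₀).card ≤ 2) (hf₁ : (G \ clF M B₁).card ≤ 2)
    (h01 : (G \ clF M B₀) ∩ (G \ clF M B₁) = ∅) :
    LocalShadowHall M 5 G := by
  have hd' : (gr M \ G).card ≤ 5 := by omega
  have hc : ∀ {B : Finset α}, B ∈ thinMembers M 5 G → (G \ clF M B).card ≤ 2 → (G \ clF M B).card = 2 :=
    fun hB hle => le_antisymm hle
      (two_le_card_sdiff_of_not_lay0 hG hd' (mem_thinMembers.1 hB).1 (mem_thinMembers.1 hB).2)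
  obtain ⟨p, x, hpx, hP₀⟩ := Finset.card_eq_two.1 (hc hB₀ hf₀)
  obtain ⟨u, v, huv, hP₁⟩ := Finset.card_eq_two.1 (hc hB₁ hf₁)
  have hH₀ : M.eRk ((G \ {p, x} : Finset α) : Set α) ≤ ((5 : ℕ) : ℕ∞) := by
    have := eRk_clF_le_of_mem_thinMembers hB₀
    rwa [clF_eq_sdiff_sdiff_of_thin hB₀, hP₀] at this
  have hH₁ : M.eRk ((G \ {u, v} : Finset α) : Set α) ≤ ((5 : ℕ) : ℕ∞) := by
    have := eRk_clF_le_of_mem_thinMembers hB₁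
    rwa [clF_eq_sdiff_sdiff_of_thin hB₁, hP₁] at this
  have hdisj : Disjoint ({p, x} : Finset α) {u, v} := by
    rw [Finset.disjoint_left]
    intro z hz hz'
    have : z ∈ (G \ clF M B₀) ∩ (G \ clF M B₁) := Finset.mem_inter.2 ⟨hP₀ ▸ hz, hP₁ ▸ hz'⟩
    rw [h01] at this
    exact Finset.notMem_empty z this
  refine c22 hpx huv hdisj ?_ hH₀ hH₁
  intro a ha
  simp only [Finset.mem_insert, Finset.mem_singleton] at ha
  rcases ha with rfl | rfl | rfl | rfl
  · exact notMem_coloops_of_mem_sdiff_clF hG hd' hB₀ (by rw [hP₀]; simp)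
  · exact notMem_coloops_of_mem_sdiff_clF hG hd' hB₀ (by rw [hP₀]; simp)
  · exact notMem_coloops_of_mem_sdiff_clF hG hd' hB₁ (by rw [hP₁]; simp)
  · exact notMem_coloops_of_mem_sdiff_clF hG hd' hB₁ (by rw [hP₁]; simp)

open scoped Classical in
/-- **Three fat thin members with pairwise different missed pairs not forming a triangle** close the cell (given the
`K₄`, triangle-plus-pair and three-disjoint closers). -/
theorem localShadowHall_three_one_of_three_not_triangle {G : Finset α} (hG : G ∈ flatsQ M (5 + 1))
    (hd : (gr M \ G).card = 3)
    (cK4 : ∀ {p x y z : α}, p ≠ x → p ≠ y → p ≠ z → x ≠ y → x ≠ z → y ≠ z →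
      (∀ a ∈ ({p, x, y, z} : Finset α), a ∉ coloops M G) →
      (∀ a ∈ ({p, x, y, z} : Finset α), ∀ b ∈ ({p, x, y, z} : Finset α), a ≠ b →
        M.eRk ((G \ {a, b} : Finset α) : Set α) ≤ ((5 : ℕ) : ℕ∞)) → LocalShadowHall M 5 G)
    (c32 : ∀ {p x y u v : α}, p ≠ x → p ≠ y → x ≠ y → u ≠ v → Disjoint ({p, x, y} : Finset α) {u, v} →
      (∀ a ∈ ({p, x, y, u, v} : Finset α), a ∉ coloops M G) →
      M.eRk ((G \ {p, x} : Finset α) : Set α) ≤ ((5 : ℕ) : ℕ∞) →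
      M.eRk ((G \ {p, y} : Finset α) : Set α) ≤ ((5 : ℕ) : ℕ∞) →
      M.eRk ((G \ {x, y} : Finset α) : Set α) ≤ ((5 : ℕ) : ℕ∞) →
      M.eRk ((G \ {u, v} : Finset α) : Set α) ≤ ((5 : ℕ) : ℕ∞) → LocalShadowHall M 5 G)
    (c3d : ∀ {B₀ B₁ B₂ : Finset α}, B₀ ∈ thinMembers M 5 G → B₁ ∈ thinMembers M 5 G → B₂ ∈ thinMembers M 5 G →
      (G \ clF M B₀).card ≤ 2 → (G \ clF M B₁).card ≤ 2 → (G \ clF M B₂).card ≤ 2 →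
      (G \ clF M B₀) ∩ (G \ clF M B₁) = ∅ → (G \ clF M B₀) ∩ (G \ clF M B₂) = ∅ →
      (G \ clF M B₁) ∩ (G \ clF M B₂) = ∅ → LocalShadowHall M 5 G)
    {B₀ B₁ B₂ : Finset α} (hB₀ : B₀ ∈ thinMembers M 5 G) (hB₁ : B₁ ∈ thinMembers M 5 G)
    (hB₂ : B₂ ∈ thinMembers M 5 G) (hf₀ : (G \ clF M B₀).card ≤ 2) (hf₁ : (G \ clF M B₁).card ≤ 2)
    (hf₂ : (G \ clF M B₂).card ≤ 2) (h01 : G \ clF M B₀ ≠ G \ clF M B₁) (h02 : G \ clF M B₀ ≠ G \ clF M B₂)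
    (h12 : G \ clF M B₁ ≠ G \ clF M B₂)
    (hU : 3 < ((G \ clF M B₀) ∪ (G \ clF M B₁) ∪ (G \ clF M B₂)).card) :
    LocalShadowHall M 5 G := by
  by_cases hshare : ((G \ clF M B₀) ∩ (G \ clF M B₁)).Nonempty ∨ ((G \ clF M B₀) ∩ (G \ clF M B₂)).Nonempty ∨
      ((G \ clF M B₁) ∩ (G \ clF M B₂)).Nonempty
  · rcases hshare with ⟨p, hp⟩ | ⟨p, hp⟩ | ⟨p, hp⟩
    · exact localShadowHall_three_one_of_sharing_third hG hd cK4 c32 hB₀ hB₁ hB₂ hf₀ hf₁ hf₂ h01 h02 h12 hp hU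
    · refine localShadowHall_three_one_of_sharing_third hG hd cK4 c32 hB₀ hB₂ hB₁ hf₀ hf₂ hf₁ h02 h01 (Ne.symm h12)
        hp ?_
      rwa [Finset.union_right_comm]
    · refine localShadowHall_three_one_of_sharing_third hG hd cK4 c32 hB₁ hB₂ hB₀ hf₁ hf₂ hf₀ h12 (Ne.symm h01)
        (Ne.symm h02) hp ?_
      rwa [Finset.union_comm, ← Finset.union_assoc]
  · push Not at hshare
    exact c3d hB₀ hB₁ hB₂ hf₀ hf₁ hf₂ hshare.1 hshare.2.1 hshare.2.2

section SevenFiveR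

variable {α' : Type} [DecidableEq α']

/-- «distinct fat missed sets are pairwise disjoint». -/
abbrev NoMeetingFat (N : Matroid α') [N.Finite] (G : Finset α') (m : ℕ) : Prop :=
  ∀ B₀ ∈ thinMembers N 5 G, ∀ B₁ ∈ thinMembers N 5 G,
    (G \ clF N B₀).card ≤ m → (G \ clF N B₁).card ≤ m → G \ clF N B₀ ≠ G \ clF N B₁ →
      (G \ clF N B₀) ∩ (G \ clF N B₁) = ∅

/-- «three pairwise distinct fat missed sets lie in three points» (they form a triangle). -/
abbrev TriangleFat (N : Matroid α') [N.Finite] (G : Finset α') (m : ℕ) : Prop :=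
  ∀ B₀ ∈ thinMembers N 5 G, ∀ B₁ ∈ thinMembers N 5 G, ∀ B₂ ∈ thinMembers N 5 G,
    (G \ clF N B₀).card ≤ m → (G \ clF N B₁).card ≤ m → (G \ clF N B₂).card ≤ m →
      G \ clF N B₀ ≠ G \ clF N B₁ → G \ clF N B₀ ≠ G \ clF N B₂ → G \ clF N B₁ ≠ G \ clF N B₂ →
        ((G \ clF N B₀) ∪ (G \ clF N B₁) ∪ (G \ clF N B₂)).card ≤ 3

open scoped Classical in
/-- **The `(3, 1)` cell outside the new clauses closes** (given the closers available at its size). -/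
theorem localShadowHall_three_one_of_not_clauses {N : Matroid α'} [N.Finite] {G : Finset α'}
    (hG : G ∈ flatsQ N (5 + 1)) (hd : (gr N \ G).card = 3)
    (cK4 : ∀ {p x y z : α'}, p ≠ x → p ≠ y → p ≠ z → x ≠ y → x ≠ z → y ≠ z →
      (∀ a ∈ ({p, x, y, z} : Finset α'), a ∉ coloops N G) →
      (∀ a ∈ ({p, x, y, z} : Finset α'), ∀ b ∈ ({p, x, y, z} : Finset α'), a ≠ b →
        N.eRk ((G \ {a, b} : Finset α') : Set α') ≤ ((5 : ℕ) : ℕ∞)) → LocalShadowHall N 5 G)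
    (c32 : ∀ {p x y u v : α'}, p ≠ x → p ≠ y → x ≠ y → u ≠ v → Disjoint ({p, x, y} : Finset α') {u, v} →
      (∀ a ∈ ({p, x, y, u, v} : Finset α'), a ∉ coloops N G) →
      N.eRk ((G \ {p, x} : Finset α') : Set α') ≤ ((5 : ℕ) : ℕ∞) →
      N.eRk ((G \ {p, y} : Finset α') : Set α') ≤ ((5 : ℕ) : ℕ∞) →
      N.eRk ((G \ {x, y} : Finset α') : Set α') ≤ ((5 : ℕ) : ℕ∞) →
      N.eRk ((G \ {u, v} : Finset α') : Set α') ≤ ((5 : ℕ) : ℕ∞) → LocalShadowHall N 5 G)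
    (c3d : ∀ {B₀ B₁ B₂ : Finset α'}, B₀ ∈ thinMembers N 5 G → B₁ ∈ thinMembers N 5 G → B₂ ∈ thinMembers N 5 G →
      (G \ clF N B₀).card ≤ 2 → (G \ clF N B₁).card ≤ 2 → (G \ clF N B₂).card ≤ 2 →
      (G \ clF N B₀) ∩ (G \ clF N B₁) = ∅ → (G \ clF N B₀) ∩ (G \ clF N B₂) = ∅ →
      (G \ clF N B₁) ∩ (G \ clF N B₂) = ∅ → LocalShadowHall N 5 G)
    (c3 : G.card = 11 ∨ 16 ≤ G.card → ∀ {p x y : α'}, p ≠ x → p ≠ y → x ≠ y →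
      (∀ a ∈ ({p, x, y} : Finset α'), a ∉ coloops N G) →
      N.eRk ((G \ {p, x} : Finset α') : Set α') ≤ ((5 : ℕ) : ℕ∞) →
      N.eRk ((G \ {p, y} : Finset α') : Set α') ≤ ((5 : ℕ) : ℕ∞) →
      N.eRk ((G \ {x, y} : Finset α') : Set α') ≤ ((5 : ℕ) : ℕ∞) → LocalShadowHall N 5 G)
    (c22 : 16 ≤ G.card → ∀ {p x u v : α'}, p ≠ x → u ≠ v → Disjoint ({p, x} : Finset α') {u, v} →
      (∀ a ∈ ({p, x, u, v} : Finset α'), a ∉ coloops N G) →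
      N.eRk ((G \ {p, x} : Finset α') : Set α') ≤ ((5 : ℕ) : ℕ∞) →
      N.eRk ((G \ {u, v} : Finset α') : Set α') ≤ ((5 : ℕ) : ℕ∞) → LocalShadowHall N 5 G)
    (h11 : 11 ≤ G.card)
    (hnot : ¬ ((fatClosures N 5 G 2).card ≤ 3 ∧ (G.card = 11 → (fatClosures N 5 G 2).card ≤ 2 ∧ NoMeetingFat N G 2) ∧
      (12 ≤ G.card ∧ G.card ≤ 15 → TriangleFat N G 2) ∧ (16 ≤ G.card → (fatClosures N 5 G 2).card ≤ 1))) :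
    LocalShadowHall N 5 G := by
  by_cases h4 : 4 ≤ (fatClosures N 5 G 2).card
  · exact localShadowHall_three_one_of_four_le hG hd cK4 c32 c3d h4
  push Not at h4
  -- a meeting pair closes at `11, 16, 17`
  have hmeet : G.card = 11 ∨ 16 ≤ G.card → ¬ NoMeetingFat N G 2 → LocalShadowHall N 5 G := by
    intro hN hnm
    unfold NoMeetingFat at hnm
    push Not at hnm
    obtain ⟨B₀, hB₀, B₁, hB₁, hf₀, hf₁, hne, hmeet⟩ := hnm
    obtain ⟨p, hp⟩ := hmeet
    exact localShadowHall_three_one_of_meeting hG hd (c3 hN) hB₀ hB₁ hf₀ hf₁ hne hp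
  -- three closures not forming a triangle close everywhere
  have htri : ¬ TriangleFat N G 2 → LocalShadowHall N 5 G := by
    intro hnt
    unfold TriangleFat at hnt
    push Not at hnt
    obtain ⟨B₀, hB₀, B₁, hB₁, B₂, hB₂, hf₀, hf₁, hf₂, h01, h02, h12, hU⟩ := hnt
    exact localShadowHall_three_one_of_three_not_triangle hG hd cK4 c32 c3d hB₀ hB₁ hB₂ hf₀ hf₁ hf₂ h01 h02 h12 hU
  rcases (show G.card = 11 ∨ (12 ≤ G.card ∧ G.card ≤ 15) ∨ 16 ≤ G.card by omega) with hN | hN | hN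
  · -- `|G| = 11`: three closures, or a meeting pair
    by_cases hnm : NoMeetingFat N G 2
    · have h3 : (fatClosures N 5 G 2).card = 3 := by
        by_contra h3
        apply hnot
        refine ⟨by omega, fun _ => ⟨by omega, hnm⟩, fun h => absurd h.1 (by omega), fun h => absurd h (by omega)⟩
      by_cases ht : TriangleFat N G 2
      · -- a triangle: two of its pairs meet
        obtain ⟨B₀, hB₀, B₁, hB₁, B₂, hB₂, hf₀, hf₁, hf₂, h01, h02, h12⟩ :=
          exists_threeFat_of_two_lt_card_fatClosures (M := N) (q := 5) (G := G) (by omega)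
        have hU := ht B₀ hB₀ B₁ hB₁ B₂ hB₂ hf₀ hf₁ hf₂ h01 h02 h12
        exfalso
        have hd' : (gr N \ G).card ≤ 5 := by omega
        have hc₀ : (G \ clF N B₀).card = 2 := le_antisymm hf₀
          (two_le_card_sdiff_of_not_lay0 hG hd' (mem_thinMembers.1 hB₀).1 (mem_thinMembers.1 hB₀).2)
        have hc₁ : (G \ clF N B₁).card = 2 := le_antisymm hf₁
          (two_le_card_sdiff_of_not_lay0 hG hd' (mem_thinMembers.1 hB₁).1 (mem_thinMembers.1 hB₁).2)
        have hdis := hnm B₀ hB₀ B₁ hB₁ hf₀ hf₁ h01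
        have hcu : ((G \ clF N B₀) ∪ (G \ clF N B₁)).card = 4 := by
          rw [Finset.card_union_of_disjoint (Finset.disjoint_iff_inter_eq_empty.2 hdis), hc₀, hc₁]
        have := Finset.card_le_card (Finset.subset_union_left (s₁ := (G \ clF N B₀) ∪ (G \ clF N B₁))
          (s₂ := G \ clF N B₂))
        omega
      · exact htri ht
    · exact hmeet (Or.inl hN) hnm
  · -- `12 ≤ |G| ≤ 15`: the triangle clause fails
    by_cases ht : TriangleFat N G 2
    · exact absurd ⟨by omega, fun h => absurd h (by omega), fun _ => ht, fun h => absurd h (by omega)⟩ hnot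
    · exact htri ht
  · -- `|G| ≥ 16`: two closures
    have h2 : 2 ≤ (fatClosures N 5 G 2).card := by
      by_contra h2
      apply hnot
      refine ⟨by omega, fun h => absurd h (by omega), fun h => absurd h.2 (by omega), fun _ => by omega⟩
    obtain ⟨B₀, hB₀, B₁, hB₁, hf₀, hf₁, hne⟩ :=
      exists_twoFat_of_one_lt_card_fatClosures (M := N) (q := 5) (G := G) (by omega)
    by_cases hm : ((G \ clF N B₀) ∩ (G \ clF N B₁)).Nonempty
    · obtain ⟨p, hp⟩ := hm
      exact localShadowHall_three_one_of_meeting hG hd (c3 (Or.inr hN)) hB₀ hB₁ hf₀ hf₁ hne hp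
    · rw [Finset.not_nonempty_iff_eq_empty] at hm
      exact localShadowHall_three_one_of_two_disjoint hG hd (c22 hN) hB₀ hB₁ hf₀ hf₁ hm

end SevenFiveR

end PercRepro.Shadow
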